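import Mathlib.RepresentationTheory.Intertwining
import Mathlib.RepresentationTheory.Subrepresentation
import Mathlib.LinearAlgebra.Dimension.Finite
import Mathlib.LinearAlgebra.FiniteDimensional.Defs
import HarnessLib

/-!
# Multiplicities along an exhaustive filtration: `dim Hom_G(τ, ⋃ F_n) ≤ sup_n dim Hom_G(τ, F_n)`

Topic `RepresentationTheory`; namespace `Literature.RepresentationTheory`; THEOREMS ONLY (no `def`, no named fact, no instance, no notation, no `sorry`);
Mathlib only.  Cell `hodgecm-mathlib`, F0∕P3, T1a arch line: node **N4a** (the exhaustion half of the counting node N4) of the in-house road to the letter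
V19 ★ `IrreducibleUnitaryKTypeGrowth` at `U(2,1)` (skeleton draft `F0/P3/Lines-draft/T1a_V19_KTypeGrowthPaydown.A-p06g24.lean`; N1 = the `𝔭`-filtration
`F n` of A-p14 (g23), exhaustive: `⨆ F n = ⊤`).

THE STATEMENT ([KnappVogan1995, §I.3 (multiplicities of `K`-types)]; [Varadarajan1989, §5.4 (proof of Thm. 19)]).  Let `R` be a representation of a
monoid `G` on `X` (any field `k`), `τ` a representation on a FINITE-DIMENSIONAL `W`, and `F : ι → Subrepresentation R` a DIRECTED family exhausting a
subrepresentation `V` (`F i ≤ V`, every `x ∈ V` lies in some `F i`).  If `dim_k Hom_G(τ, F i) ≤ B` for all `i`, then `Hom_G(τ, V)` is finite-dimensional and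
`dim_k Hom_G(τ, V) ≤ B`: a finite linearly independent family of `G`-maps `τ → V` has all its (finite-dimensional) images inside one `F i`, where it
corestricts injectively.

THE LEAN TEXT: `exists_forall_range_le_of_directed` (finitely many `G`-maps `τ → V` land in one `F i`), `card_le_finrank_of_linearIndependent_of_range_le` (corestriction
to `F i` preserves linear independence), **`rank_intertwiningMap_le_of_exhaustion`** (`Module.rank ≤ B`), **`finite_and_finrank_intertwiningMap_le_of_exhaustion`**
(`Module.Finite` and `finrank ≤ B`), and the `ℕ`-indexed monotone form `finite_and_finrank_intertwiningMap_le_of_monotone_exhaustion` (the shape of N1's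
filtration).
HONEST LABEL: closes no registered stub by itself.  HC_CM is proved only modulo the 2 remaining named inputs (hLiu418, h413) until rung 0 closes.

## References
* A. W. Knapp, D. A. Vogan, *Cohomological Induction and Unitary Representations* (1995), §I.3 [KnappVogan1995].
* V. S. Varadarajan, *An Introduction to Harmonic Analysis on Semisimple Lie Groups* (1989), §5.4 (proof of Thm. 19) [Varadarajan1989].
* N. Bourbaki, *Algèbre*, Ch. II §1 no. 8 (finitely generated submodules of a directed union) [BourbakiAlgebre1a3].
-/

set_option autoImplicit false

noncomputable section

namespace Literature.RepresentationTheory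

open Representation

universe u v w

variable {k : Type u} [Field k] {G : Type v} [Monoid G]
  {X : Type w} [AddCommGroup X] [Module k X] {W : Type w} [AddCommGroup W] [Module k W]
  {R : Representation k G X} (τ : Representation k G W)

/-! ## §1 Finitely many `G`-maps into a directed union land in one member -/

/-- A finite-dimensional subspace of a directed union `V = ⋃ F i` of subspaces lies in one `F i` (finite basis, directedness). [cite: BourbakiAlgebre1a3, Ch. II §1 no. 8] -/
theorem exists_le_of_finiteDimensional_of_directed {ι : Type*} [Nonempty ι] (F : ι → Submodule k X) (hdir : Directed (· ≤ ·) F)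
    (S : Submodule k X) [FiniteDimensional k S] (hS : ∀ x ∈ S, ∃ i, x ∈ F i) : ∃ i, S ≤ F i := by
  classical
  let b := Module.finBasis k S
  -- each basis vector lies in some `F (j m)`
  have hj : ∀ m : Fin (Module.finrank k S), ∃ i, (b m : X) ∈ F i := fun m => hS _ (b m).2
  choose j hj using hj
  obtain ⟨i, hi⟩ := hdir.finset_le (Finset.univ.image j)
  refine ⟨i, fun x hx => ?_⟩
  have hx' : (⟨x, hx⟩ : S) ∈ Submodule.span k (Set.range b) := by rw [b.span_eq]; exact Submodule.mem_top
  have hle : (Submodule.span k (Set.range b)).map S.subtype ≤ F i := by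
    rw [Submodule.map_span, Submodule.span_le]
    rintro _ ⟨_, ⟨m, rfl⟩, rfl⟩
    exact hi (j m) (Finset.mem_image_of_mem j (Finset.mem_univ m)) (hj m)
  exact hle ⟨⟨x, hx⟩, hx', rfl⟩

/-- **Finitely many `G`-maps `τ → V` from a finite-dimensional `τ` take values in ONE member of a directed exhaustion `V = ⋃ F i`.**
[cite: KnappVogan1995, §I.3] [cite: BourbakiAlgebre1a3, Ch. II §1 no. 8] -/
theorem exists_forall_range_le_of_directed [FiniteDimensional k W] {ι : Type*} [Nonempty ι] (V : Subrepresentation R)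
    (F : ι → Subrepresentation R) (hdir : Directed (· ≤ ·) fun i => (F i).toSubmodule)
    (hex : ∀ x ∈ V.toSubmodule, ∃ i, x ∈ (F i).toSubmodule) {m : ℕ} (f : Fin m → IntertwiningMap τ V.toRepresentation) :
    ∃ i, ∀ l, (LinearMap.range (f l).toLinearMap).map V.toSubmodule.subtype ≤ (F i).toSubmodule := by
  classical
  -- the joint image, a finite-dimensional subspace of `V`
  let S : Submodule k X := ⨆ l, (LinearMap.range (f l).toLinearMap).map V.toSubmodule.subtype
  haveI : ∀ l, FiniteDimensional k ((LinearMap.range (f l).toLinearMap).map V.toSubmodule.subtype) := fun l => inferInstance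
  haveI : FiniteDimensional k S := Submodule.finiteDimensional_iSup _
  have hS : ∀ x ∈ S, ∃ i, x ∈ (F i).toSubmodule := by
    intro x hx
    have hxV : x ∈ V.toSubmodule := by
      have hle : S ≤ V.toSubmodule := iSup_le fun l => by
        rintro _ ⟨y, -, rfl⟩
        exact y.2
      exact hle hx
    exact hex x hxV
  obtain ⟨i, hi⟩ := exists_le_of_finiteDimensional_of_directed (fun i => (F i).toSubmodule) hdir S hS
  exact ⟨i, fun l => (le_iSup (fun l => (LinearMap.range (f l).toLinearMap).map V.toSubmodule.subtype) l).trans hi⟩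

/-! ## §2 Corestriction to a member preserves linear independence -/

/-- **Corestriction.**  If the `G`-maps `f l : τ → V` all land in `F ≤ V` (as subspaces of `X`), they corestrict to `G`-maps `τ → F`, and a linear relation
among the corestrictions is a linear relation among the `f l`; hence linear independence is preserved and `m ≤ dim Hom_G(τ, F)`.
[cite: KnappVogan1995, §I.3] [cite: BourbakiAlgebre1a3, Ch. II §1 no. 8] -/
theorem card_le_finrank_of_linearIndependent_of_range_le (V F : Subrepresentation R)
    [Module.Finite k (IntertwiningMap τ F.toRepresentation)] {m : ℕ} (f : Fin m → IntertwiningMap τ V.toRepresentation)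
    (hf : LinearIndependent k f) (hF : ∀ l, (LinearMap.range (f l).toLinearMap).map V.toSubmodule.subtype ≤ F.toSubmodule) :
    m ≤ Module.finrank k (IntertwiningMap τ F.toRepresentation) := by
  -- the corestrictions
  have hmem : ∀ l (w : W), ((f l w : V.toSubmodule) : X) ∈ F.toSubmodule := fun l w =>
    hF l ⟨f l w, LinearMap.mem_range_self _ w, rfl⟩
  let g : Fin m → IntertwiningMap τ F.toRepresentation := fun l =>
    { toLinearMap :=
        { toFun := fun w => ⟨((f l w : V.toSubmodule) : X), hmem l w⟩
          map_add' := fun w w' => by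
            apply Subtype.ext
            simp only [map_add, Submodule.coe_add]
          map_smul' := fun c w => by
            apply Subtype.ext
            simp only [map_smul, Submodule.coe_smul, RingHom.id_apply] }
      isIntertwining' := fun g' => by
        apply LinearMap.ext
        intro w
        apply Subtype.ext
        have h := LinearMap.congr_fun ((f l).isIntertwining' g') w
        have h' := congrArg (fun y : V.toSubmodule => (y : X)) h
        exact h' }
  have hg : ∀ l w, ((g l w : F.toSubmodule) : X) = ((f l w : V.toSubmodule) : X) := fun l w => rfl
  -- a relation among the `g l` is a relation among the `f l`
  have hgli : LinearIndependent k g := by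
    rw [Fintype.linearIndependent_iff] at hf ⊢
    intro c hc l
    refine hf c ?_ l
    apply IntertwiningMap.ext
    apply LinearMap.ext
    intro w
    apply Subtype.ext
    have h1 := congrArg (fun T : IntertwiningMap τ F.toRepresentation => ((T w : F.toSubmodule) : X)) hc
    simp only [IntertwiningMap.coe_zero, Pi.zero_apply, ZeroMemClass.coe_zero] at h1
    have hsumg : ((∑ i, c i • g i) w : F.toSubmodule) = ∑ i, c i • g i w := by
      rw [IntertwiningMap.sum_apply]
      rfl
    have hsumf : ((∑ i, c i • f i) w : V.toSubmodule) = ∑ i, c i • f i w := by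
      rw [IntertwiningMap.sum_apply]
      rfl
    rw [hsumg, Submodule.coe_sum] at h1
    rw [IntertwiningMap.toLinearMap_apply, hsumf, Submodule.coe_sum, IntertwiningMap.toLinearMap_apply, IntertwiningMap.coe_zero,
      Pi.zero_apply, ZeroMemClass.coe_zero, ← h1]
    exact Finset.sum_congr rfl fun i _ => by simp only [Submodule.coe_smul, hg]
  simpa using hgli.fintype_card_le_finrank

/-! ## §3 The bound along a directed exhaustion -/

/-- **N4a: `dim Hom_G(τ, ⋃ F i) ≤ B` if `dim Hom_G(τ, F i) ≤ B` for all `i`** (`τ` finite-dimensional, `F` directed and exhausting `V`): rank form.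
[cite: KnappVogan1995, §I.3] [cite: Varadarajan1989, §5.4 (proof of Thm. 19)] -/
theorem rank_intertwiningMap_le_of_exhaustion [FiniteDimensional k W] {ι : Type*} [Nonempty ι] (V : Subrepresentation R)
    (F : ι → Subrepresentation R) (hdir : Directed (· ≤ ·) fun i => (F i).toSubmodule)
    (hex : ∀ x ∈ V.toSubmodule, ∃ i, x ∈ (F i).toSubmodule)
    [∀ i, Module.Finite k (IntertwiningMap τ (F i).toRepresentation)] {B : ℕ}
    (hB : ∀ i, Module.finrank k (IntertwiningMap τ (F i).toRepresentation) ≤ B) :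
    Module.rank k (IntertwiningMap τ V.toRepresentation) ≤ B := by
  classical
  refine rank_le fun s hs => ?_
  -- index the finite family by `Fin s.card`
  let e := s.equivFin
  let f : Fin s.card → IntertwiningMap τ V.toRepresentation := fun l => ((e.symm l : s) : IntertwiningMap τ V.toRepresentation)
  have hf : LinearIndependent k f := hs.comp _ e.symm.injective
  obtain ⟨i, hi⟩ := exists_forall_range_le_of_directed τ V F hdir hex f
  exact (card_le_finrank_of_linearIndependent_of_range_le τ V (F i) f hf hi).trans (hB i)

/-- **N4a, finite-dimensional form**: under the same hypotheses `Hom_G(τ, V)` is finite-dimensional with `finrank ≤ B`. [cite: KnappVogan1995, §I.3]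
[cite: Varadarajan1989, §5.4 (proof of Thm. 19)] -/
theorem finite_and_finrank_intertwiningMap_le_of_exhaustion [FiniteDimensional k W] {ι : Type*} [Nonempty ι] (V : Subrepresentation R)
    (F : ι → Subrepresentation R) (hdir : Directed (· ≤ ·) fun i => (F i).toSubmodule)
    (hex : ∀ x ∈ V.toSubmodule, ∃ i, x ∈ (F i).toSubmodule)
    [∀ i, Module.Finite k (IntertwiningMap τ (F i).toRepresentation)] {B : ℕ}
    (hB : ∀ i, Module.finrank k (IntertwiningMap τ (F i).toRepresentation) ≤ B) :
    Module.Finite k (IntertwiningMap τ V.toRepresentation) ∧ Module.finrank k (IntertwiningMap τ V.toRepresentation) ≤ B := by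
  have hr := rank_intertwiningMap_le_of_exhaustion τ V F hdir hex hB
  have hlt : Module.rank k (IntertwiningMap τ V.toRepresentation) < Cardinal.aleph0 :=
    hr.trans_lt (Cardinal.natCast_lt_aleph0 (n := B))
  haveI : Module.Finite k (IntertwiningMap τ V.toRepresentation) := Module.rank_lt_aleph0_iff.mp hlt
  refine ⟨inferInstance, ?_⟩
  have h := hr
  rw [← Module.finrank_eq_rank] at h
  exact_mod_cast h

/-- **N4a for an increasing `ℕ`-filtration** (the shape of N1's `𝔭`-filtration `F n`, `⨆ F n = ⊤` inside the module `V`): if every `x ∈ V` lies in some `F n`,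
`F` is monotone and `dim Hom_G(τ, F n) ≤ B` for all `n`, then `dim Hom_G(τ, V) ≤ B`. [cite: KnappVogan1995, §I.3] [cite: Varadarajan1989, §5.4 (proof of Thm. 19)] -/
theorem finite_and_finrank_intertwiningMap_le_of_monotone_exhaustion [FiniteDimensional k W] (V : Subrepresentation R)
    (F : ℕ → Subrepresentation R) (hmono : Monotone fun n => (F n).toSubmodule)
    (hex : ∀ x ∈ V.toSubmodule, ∃ n, x ∈ (F n).toSubmodule)
    [∀ n, Module.Finite k (IntertwiningMap τ (F n).toRepresentation)] {B : ℕ}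
    (hB : ∀ n, Module.finrank k (IntertwiningMap τ (F n).toRepresentation) ≤ B) :
    Module.Finite k (IntertwiningMap τ V.toRepresentation) ∧ Module.finrank k (IntertwiningMap τ V.toRepresentation) ≤ B :=
  finite_and_finrank_intertwiningMap_le_of_exhaustion τ V F hmono.directed_le hex hB

end Literature.RepresentationTheory

end
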